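import Summits.ResolutionOfSingularities.ResolutionOfSingularities.Theorems.WildConesCampaignW46HypersurfacesCharTwoNearDichotomy
import Summits.ResolutionOfSingularities.ResolutionOfSingularities.Theorems.WildConesCampaignW46HypersurfacesCharTwoHilbertWitness

/-!
# [OURS · L1 W4.6, rung (ii) at p = 2, n = 4] THE FOURFOLD THREE-TANGENTS WITNESS `z² = u₀u₁ + u₂²u₃ + u₂u₃²`: an
# ORDER-2-CLEANED isolated double point of a fourfold hypersurface with `(e, h₂) = (2, 1)` and THREE free
# infinitely-near double points — the census bound of `CampaignW46FourfoldsOrdTwoCensus` attained in the slot's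
# target class, over every field of characteristic 2

HONEST FRAMING. Everything here is OURS: theorems about route WildCones' own TYPED point-blow-up dynamics
(`Theorems/WildConesClassicalRegimesDefs.lean`) and the seat's invariants `polarMatrix` (p502936), `milnorEmbDim`
(p498937), `milnorHilbertTwo` (p511581), `degForm` (p522667). NOTHING here is a statement of the manuscript
[Hironaka2017]; no FACT-LIST premise; AI review is weaker than expert review. Cell res-hironaka (LADDER-RESOLUTION
rung L, D-0089), slot W4.6, seat res-L1-s46-pv-4 (gen 6); host route `WildCones`, crux `ClassicalRegimes`
(stmt-ResolutionOfSingularities-16884; proved).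

THE WITNESS (gen 4's `u₀u₁ + u₂²u₃ + u₂u₃²`, p507619 / p517132: `MultP`, `OrdP`, `Isol`, `e = 2`, `h₂ = 1`, `μ = 4`). Its
polar matrix has the single hyperbolic pair `u₀u₁`, so the kernel plane is `{v₀ = v₁ = 0} = ⟨e₂, e₃⟩`; the polars are
`polar(λ, v) = λ₂v₃² + λ₃v₂²` (`∂₂a = u₃²`, `∂₃a = u₂²`); the tangent cubic is `a₃(w) = w₂²w₃ + w₂w₃²`, i.e.
`st(s + t)` on the kernel plane, with roots `e₂`, `e₃`, `e₂ + e₃`. THIS FILE checks by the near-point criterion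
(p524988) and the corank criterion (p533887) that the three roots are double successors of corank `0` (free), with
pairwise non-proportional near vectors — by the census (p543928, p553129) there are no others: EXACTLY THREE, in
dimension four, order-2-cleaned.

WHAT IS PROVED: `polarMatrix_fourMixed_row_eq_zero` (rows `2, 3` of the polar matrix vanish),
`vecMul_polarMatrix_fourMixed_of_kernel` (`v₀ = v₁ = 0` ⇒ kernel), `degForm_three_fourMixed`, `polar_fourMixed_kernel`,
`fourMixed_three_free_near_points`, `fourfold_threeTangents_witness` (existence over every field of characteristic 2).

References: [CasasAlvero2000] §3 (context only); [GreuelPfister2026] Thm 3.5 / Cor 3.7 (context);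
[Hironaka2017] Th. 16.6 p.84 — role replaced only, under adjudication; nothing of it is used.
-/

noncomputable section

-- single-problem summit: the doubled namespace component `ResolutionOfSingularities` is forced
set_option linter.dupNamespace false

open scoped BigOperators Classical

open MvPowerSeries IsLocalRing

open Literature.AlgebraicGeometry.Resolution

namespace Summit.ResolutionOfSingularities.ResolutionOfSingularities.Theorems

namespace CampaignW46.HypersurfacesCharTwo

open WildCones WildCones.MuDropCharTwoOrdP ThreefoldsCharTwo

variable {κ : Type} [Field κ]

/-! ## The polar matrix and its kernel -/

/-- [OURS · L1 W4.6] The quadratic part of `u₀u₁ + u₂²u₃ + u₂u₃²` has no monomial `u₂u_t` or `u₃u_t`: rows `2` and `3`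
of the polar matrix vanish. [folklore] -/
theorem polarMatrix_fourMixed_row_eq_zero (s t : Fin 4) (hs : s = 2 ∨ s = 3) :
    polarMatrix ((X 0 * X 1 + X 2 ^ 2 * X 3 + X 2 * X 3 ^ 2 : MvPowerSeries (Fin 4) κ)) s t = 0 := by
  simp only [polarMatrix, Matrix.of_apply]
  by_cases hst : s = t
  · rw [if_pos hst]
  rw [if_neg hst, coeff_fourMixed]
  have h1 : (Finsupp.single s 1 + Finsupp.single t 1 : Fin 4 →₀ ℕ) ≠ Finsupp.single 0 1 + Finsupp.single 1 1 := by
    intro h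
    have := DFunLike.congr_fun h s
    rcases hs with rfl | rfl <;> simp [Finsupp.single_apply] at this
  have h2 : (Finsupp.single s 1 + Finsupp.single t 1 : Fin 4 →₀ ℕ) ≠ Finsupp.single 2 2 + Finsupp.single 3 1 := by
    intro h
    have hd := congrArg Finsupp.degree h
    simp only [map_add, Finsupp.degree_single] at hd
    omega
  have h3 : (Finsupp.single s 1 + Finsupp.single t 1 : Fin 4 →₀ ℕ) ≠ Finsupp.single 2 1 + Finsupp.single 3 2 := by
    intro h
    have hd := congrArg Finsupp.degree h
    simp only [map_add, Finsupp.degree_single] at hd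
    omega
  rw [if_neg h1, if_neg h2, if_neg h3, add_zero, add_zero]

/-- [OURS · L1 W4.6] **The kernel of the polar matrix of `u₀u₁ + u₂²u₃ + u₂u₃²` contains `{v₀ = v₁ = 0}`.**
[folklore] -/
theorem vecMul_polarMatrix_fourMixed_of_kernel (v : Fin 4 → κ) (h0 : v 0 = 0) (h1 : v 1 = 0) :
    Matrix.vecMul v (polarMatrix ((X 0 * X 1 + X 2 ^ 2 * X 3 + X 2 * X 3 ^ 2 : MvPowerSeries (Fin 4) κ))) = 0 := by
  funext t
  rw [Matrix.vecMul, dotProduct, Fin.sum_univ_four, h0, h1, zero_mul, zero_mul, zero_add, zero_add,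
    polarMatrix_fourMixed_row_eq_zero 2 t (Or.inl rfl), polarMatrix_fourMixed_row_eq_zero 3 t (Or.inr rfl),
    mul_zero, mul_zero, add_zero, Pi.zero_apply]

/-! ## The tangent cubic and the polars -/

/-- [OURS · L1 W4.6] The tangent cubic of `u₀u₁ + u₂²u₃ + u₂u₃²` is `w₂²w₃ + w₂w₃²`. [folklore] -/
theorem degForm_three_fourMixed (w : Fin 4 → κ) :
    degForm 3 ((X 0 * X 1 + X 2 ^ 2 * X 3 + X 2 * X 3 ^ 2 : MvPowerSeries (Fin 4) κ)) w = w 2 ^ 2 * w 3 + w 2 * w 3 ^ 2 := by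
  rw [X_pow_eq, X_pow_eq, X_def, X_def, X_def, X_def, monomial_mul_monomial, monomial_mul_monomial,
    monomial_mul_monomial, one_mul, degForm_add, degForm_add,
    degForm_monomial_of_ne (by rw [map_add, Finsupp.degree_single, Finsupp.degree_single]; norm_num),
    degForm_monomial (by rw [map_add, Finsupp.degree_single, Finsupp.degree_single]),
    degForm_monomial (by rw [map_add, Finsupp.degree_single, Finsupp.degree_single]), Fin.prod_univ_four,
    Fin.prod_univ_four]
  simp

/-- [OURS · L1 W4.6] THE POLARS of `u₀u₁ + u₂²u₃ + u₂u₃²` at a kernel vector: for `λ` with `λ₀ = λ₁ = 0`,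
`Σₛ λₛ (∂ₛa)₂(v) = λ₂ v₃² + λ₃ v₂²` (`∂₂a = u₃²`, `∂₃a = u₂²` in characteristic two). [folklore] -/
theorem polar_fourMixed_kernel [CharP κ 2] (lam v : Fin 4 → κ) (h0 : lam 0 = 0) (h1 : lam 1 = 0) :
    ∑ s, lam s * degForm 2 (MvPowerSeries.pderiv s ((X 0 * X 1 + X 2 ^ 2 * X 3 + X 2 * X 3 ^ 2 : MvPowerSeries (Fin 4) κ))) v =
      lam 2 * v 3 ^ 2 + lam 3 * v 2 ^ 2 := by
  have h3sq : degForm 2 ((X 3 : MvPowerSeries (Fin 4) κ) ^ 2) v = v 3 ^ 2 := by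
    rw [X_pow_eq, degForm_monomial (by rw [Finsupp.degree_single]), Fin.prod_univ_four]
    simp
  have h2sq : degForm 2 ((X 2 : MvPowerSeries (Fin 4) κ) ^ 2) v = v 2 ^ 2 := by
    rw [X_pow_eq, degForm_monomial (by rw [Finsupp.degree_single]), Fin.prod_univ_four]
    simp
  rw [Fin.sum_univ_four, h0, h1, zero_mul, zero_mul, zero_add, zero_add, pderiv_fourMixed, pderiv_fourMixed]
  simp only [Fin.isValue, show (2 : Fin 4) ≠ 0 by decide, show (2 : Fin 4) ≠ 1 by decide,
    show (3 : Fin 4) ≠ 0 by decide, show (3 : Fin 4) ≠ 1 by decide, show (3 : Fin 4) ≠ 2 by decide, ↓reduceIte]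
  rw [h3sq, h2sq]

/-! ## The three free near points -/

/-- [OURS · L1 W4.6 rung (ii) at `p = 2`, `n = 4`; NOT a statement of the manuscript] **`u₀u₁ + u₂²u₃ + u₂u₃²` HAS
THREE FREE INFINITELY-NEAR DOUBLE POINTS**: the charts/translations with near vectors `e₂` (chart `2`, origin), `e₃`
(chart `3`, origin) and `e₂ + e₃` (chart `2`, `τ = e₃`) — the three roots of the kernel cubic `st(s+t)` — give double
successors of corank `0` (free: isolated, `μ = 1`, nothing after, p533887), with pairwise non-proportional near
vectors; the state is an order-2-cleaned isolated double point with `e = 2`, `h₂ = 1`, `μ = 4` (gen 4), so by the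
census (p543928, p553129) these are ALL its infinitely-near double points: exactly three, in dimension four.
[folklore] -/
theorem fourMixed_three_free_near_points [CharP κ 2] {c : (Fin 4 → ℕ) → κ}
    (hc : ser 2 4 κ c = X 0 * X 1 + X 2 ^ 2 * X 3 + X 2 * X 3 ^ 2) :
    MultP 2 4 κ c ∧ OrdP 2 4 κ c ∧ Isol 2 4 κ c ∧ milnorEmbDim 2 4 κ c = 2 ∧ milnorHilbertTwo 2 4 κ c = 1 ∧
      mu 2 4 κ c = 4 ∧
      (MultP 2 4 κ (step 2 4 κ 2 0 c) ∧ milnorEmbDim 2 4 κ (step 2 4 κ 2 0 c) = 0) ∧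
      (MultP 2 4 κ (step 2 4 κ 3 0 c) ∧ milnorEmbDim 2 4 κ (step 2 4 κ 3 0 c) = 0) ∧
      (MultP 2 4 κ (step 2 4 κ 2 (Pi.single 3 1) c) ∧ milnorEmbDim 2 4 κ (step 2 4 κ 2 (Pi.single 3 1) c) = 0) ∧
      (∀ r : κ, Function.update (0 : Fin 4 → κ) 3 1 ≠ r • Function.update (0 : Fin 4 → κ) 2 1) ∧
      (∀ r : κ, Function.update (Pi.single 3 1 : Fin 4 → κ) 2 1 ≠ r • Function.update (0 : Fin 4 → κ) 2 1) ∧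
      (∀ r : κ, Function.update (Pi.single 3 1 : Fin 4 → κ) 2 1 ≠ r • Function.update (0 : Fin 4 → κ) 3 1) := by
  have hM := multP_of_ser_eq_fourMixed hc
  have hO := ordP_of_ser_eq_fourMixed hc
  have hI := isol_of_ser_eq_fourMixed hc
  obtain ⟨hh, hμ⟩ := milnorHilbertTwo_fourMixed hc
  have he := fourfold_milnorEmbDim_eq_two_of_double_successor c 2 0 hM hO (multP_step_fourMixed hc)
  -- the three near vectors
  have hw₂ : Function.update (0 : Fin 4 → κ) 2 1 = Pi.single 2 1 := by
    funext s; fin_cases s <;> simp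
  have hw₃ : Function.update (0 : Fin 4 → κ) 3 1 = Pi.single 3 1 := by
    funext s; fin_cases s <;> simp
  have hw₂₃ : Function.update (Pi.single 3 1 : Fin 4 → κ) 2 1 = Pi.single 2 1 + Pi.single 3 1 := by
    funext s; fin_cases s <;> simp
  have hker : ∀ v : Fin 4 → κ, v 0 = 0 → v 1 = 0 → Matrix.vecMul v (polarMatrix (ser 2 4 κ c)) = 0 := by
    intro v h0 h1; rw [hc]; exact vecMul_polarMatrix_fourMixed_of_kernel v h0 h1
  have hcub : ∀ w : Fin 4 → κ, degForm 3 (ser 2 4 κ c) w = w 2 ^ 2 * w 3 + w 2 * w 3 ^ 2 := by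
    intro w; rw [hc, degForm_three_fourMixed]
  have hpol : ∀ lam v : Fin 4 → κ, lam 0 = 0 → lam 1 = 0 →
      ∑ s, lam s * degForm 2 (MvPowerSeries.pderiv s (ser 2 4 κ c)) v = lam 2 * v 3 ^ 2 + lam 3 * v 2 ^ 2 := by
    intro lam v h0 h1; rw [hc, polar_fourMixed_kernel lam v h0 h1]
  have h11 : (1 : κ) + 1 = 0 := CharTwo.add_self_eq_zero 1
  -- the three double successors
  have hM₂ : MultP 2 4 κ (step 2 4 κ 2 0 c) := by
    refine (hypersurface_multP_step_iff c 2 0 hM hI).mpr ⟨?_, ?_⟩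
    · rw [hw₂]; exact hker _ (by simp) (by simp)
    · rw [hcub, hw₂]; simp
  have hM₃ : MultP 2 4 κ (step 2 4 κ 3 0 c) := by
    refine (hypersurface_multP_step_iff c 3 0 hM hI).mpr ⟨?_, ?_⟩
    · rw [hw₃]; exact hker _ (by simp) (by simp)
    · rw [hcub, hw₃]; simp
  have hM₂₃ : MultP 2 4 κ (step 2 4 κ 2 (Pi.single 3 1) c) := by
    refine (hypersurface_multP_step_iff c 2 _ hM hI).mpr ⟨?_, ?_⟩
    · rw [hw₂₃]; exact hker _ (by simp) (by simp)
    · rw [hcub, hw₂₃]; simp [h11]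
  refine ⟨hM, hO, hI, he, hh, hμ, ⟨hM₂, ?_⟩, ⟨hM₃, ?_⟩, ⟨hM₂₃, ?_⟩, fun r h => ?_, fun r h => ?_, fun r h => ?_⟩
  · refine (hypersurface_milnorEmbDim_step_eq_zero_iff c 2 0 hM he hM₂).mpr ⟨Pi.single 3 1, hker _ (by simp) (by simp), ?_⟩
    rw [hpol _ _ (by simp) (by simp), hw₂]; simp
  · refine (hypersurface_milnorEmbDim_step_eq_zero_iff c 3 0 hM he hM₃).mpr ⟨Pi.single 2 1, hker _ (by simp) (by simp), ?_⟩
    rw [hpol _ _ (by simp) (by simp), hw₃]; simp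
  · refine (hypersurface_milnorEmbDim_step_eq_zero_iff c 2 _ hM he hM₂₃).mpr ⟨Pi.single 2 1, hker _ (by simp) (by simp), ?_⟩
    rw [hpol _ _ (by simp) (by simp), hw₂₃]; simp
  · have := congrFun h 3; rw [hw₃, hw₂] at this; simp at this
  · have := congrFun h 3; rw [hw₂₃, hw₂] at this; simp at this
  · have := congrFun h 2; rw [hw₂₃, hw₃] at this; simp at this

/-- [OURS · L1 W4.6 rung (ii) at `p = 2`, `n = 4`; NOT a statement of the manuscript] **THE FOURFOLD `D₄` NODE IS
INHABITED WITH ITS BOUND ATTAINED**, over every field of characteristic `2`: there is an order-2-cleaned isolated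
double state of a fourfold hypersurface `z² = a(u₀,u₁,u₂,u₃)` with `e = 2`, `h₂ = 1`, `μ = 4` and three double
successors of corank `0` at pairwise non-proportional near vectors — non-vacuity of the middle branch of
`CampaignW46FourfoldsOrdTwoCensus` (`…CorankTwoCountHilbert`, `…HilbertOneCensus`) at `n = 4` with the count `3`
attained. [folklore] -/
theorem fourfold_threeTangents_witness (κ : Type) [Field κ] [CharP κ 2] :
    ∃ c : (Fin 4 → ℕ) → κ, MultP 2 4 κ c ∧ OrdP 2 4 κ c ∧ Isol 2 4 κ c ∧ milnorEmbDim 2 4 κ c = 2 ∧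
      milnorHilbertTwo 2 4 κ c = 1 ∧ mu 2 4 κ c = 4 ∧
      (MultP 2 4 κ (step 2 4 κ 2 0 c) ∧ milnorEmbDim 2 4 κ (step 2 4 κ 2 0 c) = 0) ∧
      (MultP 2 4 κ (step 2 4 κ 3 0 c) ∧ milnorEmbDim 2 4 κ (step 2 4 κ 3 0 c) = 0) ∧
      (MultP 2 4 κ (step 2 4 κ 2 (Pi.single 3 1) c) ∧ milnorEmbDim 2 4 κ (step 2 4 κ 2 (Pi.single 3 1) c) = 0) ∧
      (∀ r : κ, Function.update (0 : Fin 4 → κ) 3 1 ≠ r • Function.update (0 : Fin 4 → κ) 2 1) ∧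
      (∀ r : κ, Function.update (Pi.single 3 1 : Fin 4 → κ) 2 1 ≠ r • Function.update (0 : Fin 4 → κ) 2 1) ∧
      (∀ r : κ, Function.update (Pi.single 3 1 : Fin 4 → κ) 2 1 ≠ r • Function.update (0 : Fin 4 → κ) 3 1) := by
  obtain ⟨c, hc⟩ := exists_ser_eq (X 0 * X 1 + X 2 ^ 2 * X 3 + X 2 * X 3 ^ 2 : MvPowerSeries (Fin 4) κ)
    fourMixed_coeff_eq_zero_of_even
  exact ⟨c, fourMixed_three_free_near_points hc⟩

end CampaignW46.HypersurfacesCharTwo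

end Summit.ResolutionOfSingularities.ResolutionOfSingularities.Theorems

end
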